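import Literature.Analysis.FluidPDE.ForcedFourierForcePressureData
import HarnessLib

/-!
# The Leray projection `P f` of a Schwartz-on-slab force, as a PHYSICAL field: continuity, sup
# bound, divergence freeness, `L²` bound, and the re-gauge `(u, p, f) ↦ (u, p - Δ⁻¹∇·f, P f)`

Analysis/FluidPDE file (one plumbing definition; theorems proved; no named facts). The tree's
raw-force gauge (`ForcedFourierForcePressure`, `ForcedFourierForcePressureData`; T. Tao, Anal. PDE 6
(2013) = arXiv:1108.1165, (7)–(8): Duhamel formula with force and the normalised pressure
`p = -Δ⁻¹∂ᵢ∂ⱼ(uᵢuⱼ) + Δ⁻¹∇·f`, so that `-∇p + f = ⋯ + P f`) produces, for a force `f` which is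
Schwartz on the closed slab `[0, T] × ℝ³`, the Fourier-side PROJECTED force
`b t = lerayPart (forceData hT hf hd t)` and the force pressure `p_f(t) = Re 𝓕 forcePresSymbol (…)`
with `∇p_f(t) = f(t) - synthVel (b t)`. This file packages the physical projected force

  `clayProjForce hT hf hd t x = synthVel (lerayPart (forceData hT hf hd t)) x`   (`= P f (t, x)`),

with exactly the properties the forced Oseen representation
(`ForcedOseenRepresentation(Classical).lean`) asks of its force:

* `norm_synthVel_le_sum_integral` — `‖synthVel V x‖ ≤ Σₗ ∫ ‖Vₗ‖` (Riemann–Lebesgue size bound);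
* `isDivFree_synthVel_of_decay` — a raw Fourier datum with `Σₗ ξₗ Vₗ(ξ) = 0`, measurable
  components and decay of order `5` synthesizes a (classically) DIVERGENCE-FREE field
  (derivative under the Fourier integral, `fderiv_fourier_apply_of_integrable`, and linearity);
* `clayProjForce_eq_sub_gradient` — `P f(t) = f(clamp T t) - ∇p_f(t)` for every real `t`
  (`gradient_forcePressure_forceData`);
* `continuous_uncurry_clayProjForce` — `P f` is jointly continuous on `ℝ × ℝ³` (time is
  clamped to `[0, T]`; on the slab `f` and `∇p_f` are jointly smooth);
* `exists_norm_clayProjForce_le` — a uniform sup bound `‖P f(t, x)‖ ≤ G`;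
* `isDivFree_clayProjForce`, `isWeaklyDivFree_clayProjForce` — `div P f(t) = 0`;
* `exists_eLpNorm_two_clayProjForce_le` — a uniform `L²` bound `‖P f(t)‖₂ ≤ G₂ < ∞`
  (Plancherel, `lintegral_levelSq_synthVel_eq_of_moments`, and the square-integrable decay
  envelope);
* `IsClassicalNSSolutionOn.to_clayProjForce` — **the re-gauge**: a classical solution `(u, p)` of
  the system driven by `f` on `[0, T]` is a classical solution `(u, p - p_f)` of the system driven
  by `P f` (`IsClassicalNSSolutionOn.add_gradient` with `p₂ = -p_f`); the converse direction is the
  tree's `IsClassicalNSSolutionOn.of_lerayPart_forceData`.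

Cell `ns-blowup` labels: LABEL Literature port; bears_on LADDER-NS N1
(route-NavierStokesRegularity-PalasekTowerBreakdown, crux 19249 via the E–C cone: R5
`lemarieRieusset2016_lerayRate_forced`; base crux 19179 via the hold-and-release trap «Hmin»);
WHAT THIS IS NOT: not NS — linear Fourier bookkeeping of the gradient part of a forcing term.

## Mathlib / tree search

Tree: `forceData`, `synthVel_forceData`, `continuous_force_clamp_uncurry`, `clamp`,
`clamp_clamp`, `clamp_mem_Icc` (`ForcedFourierForceData`, `NSFourierPicard`); `lerayPart`,
`hasDecay_lerayPart_forceData_uniform`, `aestronglyMeasurable_lerayPart_forceData_apply`,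
`sum_mul_lerayPart_forceData`, `lerayPart_forceData_conj_symm`,
`isSmoothSpaceTimeOn_forcePressure_forceData`, `gradient_forcePressure_forceData`
(`ForcedFourierForcePressureData`); `IsClassicalNSSolutionOn.add_gradient`,
`IsSmoothSpaceTimeOn.gradient/.const_smul` (`ForcedFourierForcePressure`,
`ClassicalSolutionCalculus`); `synthVel_eq_comp`, `reVec`, `fderiv_fourier_apply_of_integrable`,
`integrable_letterSymbol_mul`, `fourier_finset_sum'`, `fourier_zero'`, `HasDecay.integrable`,
`HasDecay.integrable_pow_mul_norm`, `integrable_inv_one_add_norm_pow`,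
`lintegral_levelSq_synthVel_eq_of_moments`, `levelSq_zero_eq_norm_sq`
(`TaoH1FourierMildSolution/Classical`, `NSFourierBilinear`, `NSFourierWeights`,
`CoordDerivatives`); `divergence_eq_sum_inner_fderiv`,
`VectorCalculus.IsDivFree.isWeaklyDivFree_holds` (`VectorCalculus`). A physical `P f` with these
properties did not exist (`lean search 'clayProjForce|projForce|isDivFree_synthVel_of'`: only the
structure-bound `IsSobolevMild.isDivFree_u` / `BPS.isDivFree_synthVel`). Mathlib:
`Real.differentiable_fourier`, `VectorFourier.norm_fourierIntegral_le_integral_norm`,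
`EuclideanSpace.basisFun`, `hasFDerivAt_pi`.

## References

* T. Tao, Anal. PDE 6 (2013) 25–107 = arXiv:1108.1165, (7)–(8) p. 3; Thm. 5.4 (iv). [Tao2011]
* P. G. Lemarié-Rieusset, *The Navier–Stokes Problem in the 21st Century*, CRC 2016, §6.1 (the
  Leray projection `P = Id - ∇Δ⁻¹div`, symbol `δⱼₖ - ξⱼξₖ/|ξ|²`), Thm. 6.1 (6.12). [LemarieRieusset2016]
-/

noncomputable section

open MeasureTheory Real Set Filter Function Complex FourierTransform
open scoped FourierTransform RealInnerProductSpace ENNReal NNReal ContDiff ComplexConjugate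
open _root_.Topology

namespace Literature.Analysis.FluidPDE

open FourierNS

/-! ### Generic facts about synthesized fields `synthVel V = Re 𝓕 V` -/

section Synth

variable {ι : Type*} [Fintype ι] [DecidableEq ι]

/-- `ℓ² ≤ ℓ¹` on `EuclideanSpace`: `‖v‖ ≤ Σₗ ‖vₗ‖` (expand `v` in the standard basis). [folklore] -/
private theorem norm_le_sum_norm_apply (v : EuclideanSpace ℝ ι) : ‖v‖ ≤ ∑ l, ‖v l‖ := by
  have h : v = ∑ l, v l • EuclideanSpace.single l (1 : ℝ) := by
    have := (EuclideanSpace.basisFun ι ℝ).sum_repr v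
    simp only [EuclideanSpace.basisFun_repr, EuclideanSpace.basisFun_apply] at this
    exact this.symm
  calc ‖v‖ = ‖∑ l, v l • EuclideanSpace.single l (1 : ℝ)‖ := by rw [← h]
    _ ≤ ∑ l, ‖v l • EuclideanSpace.single l (1 : ℝ)‖ := norm_sum_le _ _
    _ = ∑ l, ‖v l‖ := by
        refine Finset.sum_congr rfl fun l _ => ?_
        rw [norm_smul]
        simp [PiLp.norm_single]

/-- **Size of a synthesized field**: `‖synthVel V x‖ ≤ Σₗ ∫ ‖V ξ l‖ dξ` (the Fourier integral is
bounded by the `L¹` norm of its integrand, componentwise). [cite: LemarieRieusset2016, §6.1] -/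
theorem norm_synthVel_le_sum_integral (V : EuclideanSpace ℝ ι → ι → ℂ) (x : EuclideanSpace ℝ ι) :
    ‖synthVel V x‖ ≤ ∑ l, ∫ ξ, ‖V ξ l‖ := by
  refine (norm_le_sum_norm_apply _).trans (Finset.sum_le_sum fun l _ => ?_)
  rw [synthVel_apply]
  calc ‖(𝓕 (fun ξ => V ξ l) x).re‖ ≤ ‖𝓕 (fun ξ => V ξ l) x‖ := Complex.abs_re_le_norm _
    _ ≤ ∫ ξ, ‖V ξ l‖ := VectorFourier.norm_fourierIntegral_le_integral_norm _ _ _ _ _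

/-- **A divergence-free raw datum synthesizes a divergence-free field.** If `V : ℝ^ι → ℂ^ι` has
a.e.-strongly measurable components, decay of order `card ι + 2` (so that `V` and `‖ξ‖‖V‖` are
integrable) and `Σₗ ξₗ V(ξ)ₗ = 0` for every `ξ`, then `div (synthVel V) = 0` everywhere:
`∂ₗ Re 𝓕 Vₗ = Re 𝓕 (-2πi ξₗ Vₗ)` (derivative under the Fourier integral) and linearity.
(Template: the tree's structure-bound `IsSobolevMild.isDivFree_u`.) [cite: LemarieRieusset2016, §6.1] -/
theorem isDivFree_synthVel_of_decay {V : EuclideanSpace ℝ ι → ι → ℂ} {B : ℝ}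
    (hdec : HasDecay (1 + (Fintype.card ι + 1)) B V)
    (hmeas : ∀ l, AEStronglyMeasurable (fun ξ => V ξ l) volume)
    (hdiv : ∀ ξ, ∑ l, ((ξ l : ℝ) : ℂ) * V ξ l = 0) :
    VectorCalculus.IsDivFree (synthVel V) := by
  classical
  have hdim : Module.finrank ℝ (EuclideanSpace ℝ ι) < Fintype.card ι + 1 := by
    rw [finrank_euclideanSpace]; omega
  have hint : ∀ l, Integrable (fun ξ => V ξ l) volume := fun l =>
    ((hdec.of_le (by omega)).apply l).integrable hdim (hmeas l)
  have hint1 : ∀ l, Integrable (fun ξ : EuclideanSpace ℝ ι => ‖ξ‖ * ‖V ξ l‖) volume := fun l => by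
    have h := (hdec.apply l).integrable_pow_mul_norm (n := 1) hdim (hmeas l)
    simpa only [pow_one] using h
  have hdiff : ∀ l, Differentiable ℝ (𝓕 (fun ξ => V ξ l)) := fun l =>
    Real.differentiable_fourier (hint l) (hint1 l)
  intro x
  -- the derivative of the synthesized field
  have hpi : HasFDerivAt (fun y => fun l => 𝓕 (fun ξ => V ξ l) y)
      (ContinuousLinearMap.pi fun l => fderiv ℝ (𝓕 (fun ξ => V ξ l)) x) x :=
    hasFDerivAt_pi.2 fun l => ((hdiff l) x).hasFDerivAt
  have h1 : HasFDerivAt (synthVel V)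
      ((ClayDatum.reVec (ι := ι)).comp (ContinuousLinearMap.pi fun l => fderiv ℝ (𝓕 (fun ξ => V ξ l)) x)) x := by
    rw [synthVel_eq_comp]
    exact (ClayDatum.reVec (ι := ι)).hasFDerivAt.comp x hpi
  have hcomp : ∀ h' : EuclideanSpace ℝ ι, ∀ l, fderiv ℝ (synthVel V) x h' l =
      (𝓕 (fun ξ => (-(2 * π * I) * (⟪ξ, h'⟫ : ℂ)) * V ξ l) x).re := by
    intro h' l
    rw [h1.fderiv, ContinuousLinearMap.comp_apply, ClayDatum.reVec_apply, ContinuousLinearMap.pi_apply,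
      fderiv_fourier_apply_of_integrable (hint l) (hint1 l)]
  rw [divergence_eq_sum_inner_fderiv (EuclideanSpace.basisFun ι ℝ)]
  have hterm : ∀ l, ⟪(EuclideanSpace.basisFun ι ℝ) l,
      fderiv ℝ (synthVel V) x ((EuclideanSpace.basisFun ι ℝ) l)⟫ =
      (𝓕 (fun ξ => (-(2 * π * I) * ((ξ l : ℝ) : ℂ)) * V ξ l) x).re := by
    intro l
    rw [EuclideanSpace.basisFun_apply, EuclideanSpace.inner_single_left, hcomp]
    simp only [conj_trivial, one_mul, EuclideanSpace.inner_single_right]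
  simp_rw [hterm]
  rw [← Complex.re_sum]
  have hint' : ∀ l ∈ (Finset.univ : Finset ι), Integrable fun ξ : EuclideanSpace ℝ ι =>
      (-(2 * π * I) * ((ξ l : ℝ) : ℂ)) * V ξ l := fun l _ =>
    integrable_letterSymbol_mul (hint1 l) (hmeas l) l
  rw [← FourierNS.fourier_finset_sum' Finset.univ hint']
  have hzero : (fun ξ : EuclideanSpace ℝ ι => ∑ l, (-(2 * π * I) * ((ξ l : ℝ) : ℂ)) * V ξ l) =
      fun _ => 0 := by
    funext ξ
    calc ∑ l, (-(2 * π * I) * ((ξ l : ℝ) : ℂ)) * V ξ l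
        = -(2 * π * I) * ∑ l, ((ξ l : ℝ) : ℂ) * V ξ l := by
          rw [Finset.mul_sum]; refine Finset.sum_congr rfl fun l _ => ?_; ring
      _ = 0 := by rw [hdiv ξ, mul_zero]
  rw [hzero, FourierNS.fourier_zero', Complex.zero_re]

end Synth

/-! ### The physical projected force `P f` of a Schwartz-on-slab force on `ℝ³` -/

section Proj

variable {T : ℝ} {f : ℝ → EuclideanSpace ℝ (Fin 3) → EuclideanSpace ℝ (Fin 3)}

/-- **The Leray projection of a Schwartz-on-slab force, as a physical field**:
`clayProjForce hT hf hd t x = synthVel (lerayPart (forceData hT hf hd t)) x = (P f)(clamp T t, x)`,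
`P = Id - ∇Δ⁻¹div` (Lemarié-Rieusset 2016, §6.1; Tao 2013, (8): `-∇p + f = -∇(-Δ⁻¹∂ᵢ∂ⱼ(uᵢuⱼ)) + P f`).
Time is clamped to `[0, T]` by `forceData`, so the field is defined and continuous on all of
`ℝ × ℝ³`. [cite: LemarieRieusset2016, §6.1] [cite: Tao2011, (8) p. 3] -/
def clayProjForce (hT : 0 < T) (hf : IsSmoothSpaceTimeOn (Icc 0 T) f)
    (hd : HasUniformRapidDecayOn (Icc 0 T) f) (t : ℝ) (x : EuclideanSpace ℝ (Fin 3)) :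
    EuclideanSpace ℝ (Fin 3) :=
  synthVel (lerayPart (forceData hT hf hd t)) x

variable (hT : 0 < T) (hf : IsSmoothSpaceTimeOn (Icc 0 T) f) (hd : HasUniformRapidDecayOn (Icc 0 T) f)

/-- Unfolding `clayProjForce`. [cite: LemarieRieusset2016, §6.1] -/
theorem clayProjForce_apply (t : ℝ) (x : EuclideanSpace ℝ (Fin 3)) :
    clayProjForce hT hf hd t x = synthVel (lerayPart (forceData hT hf hd t)) x := rfl

/-- The Fourier-side force only sees the clamped time: `forceData (clamp T t) = forceData t`. [cite: Tao2011, Thm. 5.4 proof (arXiv Thm. 31, p. 18)] -/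
theorem forceData_clamp (t : ℝ) : forceData hT hf hd (clamp T t) = forceData hT hf hd t := by
  funext ξ l
  rw [forceData_apply, forceData_apply, clamp_clamp hT.le]

/-- `P f` only sees the clamped time. [cite: LemarieRieusset2016, §6.1] -/
theorem clayProjForce_clamp (t : ℝ) : clayProjForce hT hf hd (clamp T t) = clayProjForce hT hf hd t := by
  funext x
  rw [clayProjForce_apply, clayProjForce_apply, forceData_clamp]

/-- **`P f = f - ∇Δ⁻¹∇·f`**: for every real `t` and every `x`,
`clayProjForce hT hf hd t x = f (clamp T t) x - ∇p_f(t)(x)`,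
`p_f(t) = Re 𝓕 forcePresSymbol (forceData … t)`. [cite: Tao2011, (8) p. 3] -/
theorem clayProjForce_eq_sub_gradient (t : ℝ) (x : EuclideanSpace ℝ (Fin 3)) :
    clayProjForce hT hf hd t x = f (clamp T t) x -
      gradient (fun y => (𝓕 (forcePresSymbol (forceData hT hf hd t)) y).re) x := by
  rw [gradient_forcePressure_forceData hT hf hd t x, clayProjForce_apply]
  abel

/-- On the slab: `P f(t) = f(t) - ∇p_f(t)` for `t ∈ [0, T]`. [cite: Tao2011, (8) p. 3] -/
theorem clayProjForce_eq_sub_gradient_of_mem {t : ℝ} (ht : t ∈ Icc 0 T)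
    (x : EuclideanSpace ℝ (Fin 3)) :
    clayProjForce hT hf hd t x = f t x -
      gradient (fun y => (𝓕 (forcePresSymbol (forceData hT hf hd t)) y).re) x := by
  rw [clayProjForce_eq_sub_gradient, clamp_of_mem ht]

/-- **`P f` is jointly smooth on the slab** `[0, T] × ℝ³` (`f` and `∇p_f` are). [cite: Tao2011, Thm. 5.4 (iv) with (8)] -/
theorem isSmoothSpaceTimeOn_clayProjForce : IsSmoothSpaceTimeOn (Icc 0 T) (clayProjForce hT hf hd) := by
  have hp := (isSmoothSpaceTimeOn_forcePressure_forceData hT hf hd).gradient (uniqueDiffOn_Icc hT)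
  have h : IsSmoothSpaceTimeOn (Icc 0 T) (fun t x => f t x -
      gradient (fun y => (𝓕 (forcePresSymbol (forceData hT hf hd t)) y).re) x) := hf.sub hp
  have heq : EqOn (uncurry (clayProjForce hT hf hd)) (uncurry fun t x => f t x -
      gradient (fun y => (𝓕 (forcePresSymbol (forceData hT hf hd t)) y).re) x)
      (Icc 0 T ×ˢ (univ : Set (EuclideanSpace ℝ (Fin 3)))) := by
    intro q hq
    rw [mem_prod] at hq
    exact clayProjForce_eq_sub_gradient_of_mem hT hf hd hq.1 q.2
  unfold IsSmoothSpaceTimeOn at h ⊢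
  exact h.congr heq

/-- **`P f` is jointly continuous on `ℝ × ℝ³`** (continuous on the slab, and time is clamped). [cite: Tao2011, Thm. 5.4 (iv) with (8)] -/
theorem continuous_uncurry_clayProjForce : Continuous (uncurry (clayProjForce hT hf hd)) := by
  have hc : ContinuousOn (uncurry (clayProjForce hT hf hd)) (Icc 0 T ×ˢ univ) :=
    (isSmoothSpaceTimeOn_clayProjForce hT hf hd).continuousOn
  have hmap : Continuous fun q : ℝ × EuclideanSpace ℝ (Fin 3) =>
      ((clamp T q.1, q.2) : ℝ × EuclideanSpace ℝ (Fin 3)) :=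
    ((continuous_clamp T).comp continuous_fst).prodMk continuous_snd
  have hmem : ∀ q : ℝ × EuclideanSpace ℝ (Fin 3),
      ((clamp T q.1, q.2) : ℝ × EuclideanSpace ℝ (Fin 3)) ∈ Icc 0 T ×ˢ (univ : Set _) := fun q =>
    mk_mem_prod (clamp_mem_Icc hT.le q.1) (mem_univ _)
  have h := hc.comp_continuous hmap hmem
  refine h.congr fun q => ?_
  simp only [Function.comp_apply, uncurry]
  rw [clayProjForce_clamp]

/-- Continuity of every time slice of `P f`. [cite: Tao2011, Thm. 5.4 (iv) with (8)] -/
theorem continuous_clayProjForce_slice (t : ℝ) : Continuous (clayProjForce hT hf hd t) := by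
  have h := (continuous_uncurry_clayProjForce hT hf hd).comp
    (continuous_const.prodMk continuous_id : Continuous fun x : EuclideanSpace ℝ (Fin 3) => (t, x))
  have heq : clayProjForce hT hf hd t = uncurry (clayProjForce hT hf hd) ∘ fun x => (t, x) := by
    funext x
    simp only [Function.comp_apply, uncurry]
  rw [heq]
  exact h

/-- **A uniform sup bound for `P f`**: `‖P f(t, x)‖ ≤ G` for all real `t` and all `x`, with
`G = 3 B ∫ (1 + ‖ξ‖)⁻⁴ dξ`, `B` the uniform order-`4` decay constant of the projected Fourier force
(Riemann–Lebesgue size bound `norm_synthVel_le_sum_integral`). [cite: LemarieRieusset2016, §6.1] -/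
theorem exists_norm_clayProjForce_le :
    ∃ G : ℝ, 0 ≤ G ∧ ∀ t x, ‖clayProjForce hT hf hd t x‖ ≤ G := by
  obtain ⟨B, hB0, hB⟩ := hasDecay_lerayPart_forceData_uniform hT hf hd 4
  have hdim : Module.finrank ℝ (EuclideanSpace ℝ (Fin 3)) < 4 := by
    rw [finrank_euclideanSpace, Fintype.card_fin]; norm_num
  set IK : ℝ := ∫ ξ : EuclideanSpace ℝ (Fin 3), ((1 + ‖ξ‖) ^ 4)⁻¹ with hIK
  have hIK0 : 0 ≤ IK := integral_nonneg fun ξ => by positivity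
  refine ⟨3 * (B * IK), by positivity, fun t x => ?_⟩
  have hl : ∀ l : Fin 3, ∫ ξ, ‖lerayPart (forceData hT hf hd t) ξ l‖ ≤ B * IK := by
    intro l
    have hle : ∀ ξ, ‖lerayPart (forceData hT hf hd t) ξ l‖ ≤ B * ((1 + ‖ξ‖) ^ 4)⁻¹ := fun ξ =>
      (hB t).apply l ξ
    calc ∫ ξ, ‖lerayPart (forceData hT hf hd t) ξ l‖ ≤ ∫ ξ, B * ((1 + ‖ξ‖) ^ 4)⁻¹ := by
          refine integral_mono_of_nonneg (Eventually.of_forall fun ξ => norm_nonneg _)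
            ((integrable_inv_one_add_norm_pow hdim).const_mul B) (Eventually.of_forall hle)
      _ = B * IK := by rw [integral_const_mul, hIK]
  calc ‖clayProjForce hT hf hd t x‖ ≤ ∑ l, ∫ ξ, ‖lerayPart (forceData hT hf hd t) ξ l‖ :=
        norm_synthVel_le_sum_integral _ _
    _ ≤ ∑ _l : Fin 3, B * IK := Finset.sum_le_sum fun l _ => hl l
    _ = 3 * (B * IK) := by simp

/-- **`P f` is divergence free** at every time (classically: `div P f(t) = 0`). [cite: LemarieRieusset2016, §6.1] -/
theorem isDivFree_clayProjForce (t : ℝ) : VectorCalculus.IsDivFree (clayProjForce hT hf hd t) := by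
  obtain ⟨B, -, hB⟩ := hasDecay_lerayPart_forceData_uniform hT hf hd (1 + (Fintype.card (Fin 3) + 1))
  have h := isDivFree_synthVel_of_decay (hB t) (aestronglyMeasurable_lerayPart_forceData_apply hT hf hd t)
    (sum_mul_lerayPart_forceData hT hf hd t)
  exact h

/-- **`P f` is weakly divergence free** at every time. [cite: LemarieRieusset2016, §6.1] -/
theorem isWeaklyDivFree_clayProjForce (t : ℝ) : IsWeaklyDivFree (clayProjForce hT hf hd t) := by
  have h1 : ContDiff ℝ 1 (clayProjForce hT hf hd t) := by
    have h := (isSmoothSpaceTimeOn_clayProjForce hT hf hd).contDiff_slice (clamp_mem_Icc hT.le t)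
    rw [clayProjForce_clamp] at h
    exact h.of_le (by norm_cast)
  exact VectorCalculus.IsDivFree.isWeaklyDivFree_holds (isDivFree_clayProjForce hT hf hd t) h1

/-- **A uniform `L²` bound for `P f`**: there is `G₂ < ∞` with `‖P f(t)‖_{L²} ≤ G₂` for all real
`t` (Plancherel for the synthesized field, `lintegral_levelSq_synthVel_eq_of_moments` at order `0`,
against the square-integrable envelope `B (1 + ‖ξ‖)⁻²` of the projected Fourier force). [cite: LemarieRieusset2016, §6.1] -/
theorem exists_eLpNorm_two_clayProjForce_le :
    ∃ G₂ : ℝ≥0∞, G₂ ≠ ⊤ ∧ ∀ t, eLpNorm (clayProjForce hT hf hd t) 2 volume ≤ G₂ := by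
  obtain ⟨B, hB0, hB⟩ := hasDecay_lerayPart_forceData_uniform hT hf hd 2
  -- the envelope `G l ξ = B (1 + ‖ξ‖)⁻²` is square integrable on `ℝ³`
  set Genv : Fin 3 → EuclideanSpace ℝ (Fin 3) → ℝ := fun _ ξ => B * ((1 + ‖ξ‖) ^ 2)⁻¹ with hGenv
  have hdim4 : Module.finrank ℝ (EuclideanSpace ℝ (Fin 3)) < 4 := by
    rw [finrank_euclideanSpace, Fintype.card_fin]; norm_num
  have hGsq : ∀ ξ : EuclideanSpace ℝ (Fin 3), (B * ((1 + ‖ξ‖) ^ 2)⁻¹) ^ 2 = B ^ 2 * ((1 + ‖ξ‖) ^ 4)⁻¹ := by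
    intro ξ
    have h1 : 0 < 1 + ‖ξ‖ := by positivity
    field_simp
  have hGint : Integrable (fun ξ : EuclideanSpace ℝ (Fin 3) => (B * ((1 + ‖ξ‖) ^ 2)⁻¹) ^ 2) volume := by
    simp_rw [hGsq]
    exact (integrable_inv_one_add_norm_pow hdim4).const_mul _
  have hpow : Continuous fun ξ : EuclideanSpace ℝ (Fin 3) => (1 + ‖ξ‖) ^ 2 :=
    (continuous_const.add continuous_norm).pow 2
  have hGcont : Continuous fun ξ : EuclideanSpace ℝ (Fin 3) => B * ((1 + ‖ξ‖) ^ 2)⁻¹ :=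
    continuous_const.mul (hpow.inv₀ fun ξ => by positivity)
  have hGmem : ∀ l, MemLp (Genv l) 2 (volume : Measure (EuclideanSpace ℝ (Fin 3))) := by
    intro l
    refine (memLp_two_iff_integrable_sq hGcont.aestronglyMeasurable).2 ?_
    exact hGint
  set G₂sq : ℝ≥0∞ := ENNReal.ofReal ((2 * π) ^ (2 * 0)) *
      ∫⁻ ξ : EuclideanSpace ℝ (Fin 3), ENNReal.ofReal (‖ξ‖ ^ (2 * 0)) *
        ∑ _l : Fin 3, ENNReal.ofReal ((B * ((1 + ‖ξ‖) ^ 2)⁻¹) ^ 2) with hG₂sq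
  have hG₂sq_top : G₂sq ≠ ⊤ := by
    rw [hG₂sq]
    refine ENNReal.mul_ne_top ENNReal.ofReal_ne_top (ne_of_lt ?_)
    simp only [mul_zero, pow_zero, ENNReal.ofReal_one, one_mul]
    rw [lintegral_finsetSum' _ fun l _ => hGint.aestronglyMeasurable.aemeasurable.ennreal_ofReal]
    refine ENNReal.sum_lt_top.2 fun l _ => ?_
    exact (lintegral_ofReal_le_lintegral_enorm _).trans_lt hGint.2
  refine ⟨G₂sq ^ (1 / 2 : ℝ), ENNReal.rpow_ne_top_of_nonneg (by norm_num) hG₂sq_top, fun t => ?_⟩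
  set V := fun ξ => lerayPart (forceData hT hf hd t) ξ with hV
  have hmeas : ∀ l, AEStronglyMeasurable (fun ξ => V ξ l) volume := fun l =>
    aestronglyMeasurable_lerayPart_forceData_apply hT hf hd t l
  have hmom : ∀ (k : ℕ) (l : Fin 3), Integrable (fun ξ : EuclideanSpace ℝ (Fin 3) => ‖ξ‖ ^ k * ‖V ξ l‖) volume := by
    intro k l
    obtain ⟨B', -, hB'⟩ := hasDecay_lerayPart_forceData_uniform hT hf hd (k + 4)
    exact ((hB' t).apply l).integrable_pow_mul_norm hdim4 (hmeas l)
  have hconj : ∀ ξ l, V (-ξ) l = conj (V ξ l) := fun ξ l => lerayPart_forceData_conj_symm hT hf hd t ξ l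
  have hle : ∀ ξ l, ‖ξ‖ ^ 0 * ‖V ξ l‖ ≤ Genv l ξ := fun ξ l => by
    rw [pow_zero, one_mul]; exact (hB t).apply l ξ
  have hP := lintegral_levelSq_synthVel_eq_of_moments V hmeas hmom hconj 0 hGmem hle
  -- `∫ ‖P f(t)‖² = ∫ levelSq 0 ≤ G₂sq`
  have hsq : ∫⁻ x, ‖clayProjForce hT hf hd t x‖ₑ ^ 2 ≤ G₂sq := by
    have heq : ∀ x, ‖clayProjForce hT hf hd t x‖ₑ ^ 2 =
        ENNReal.ofReal (levelSq 0 (synthVel V) x) := by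
      intro x
      rw [levelSq_zero_eq_norm_sq, ← ofReal_norm, ← ENNReal.ofReal_pow (norm_nonneg _)]
      rfl
    simp_rw [heq]
    rw [hP, hG₂sq]
    gcongr with ξ l
    rw [← ofReal_norm, ← ENNReal.ofReal_pow (norm_nonneg _)]
    refine ENNReal.ofReal_le_ofReal ?_
    have h0 : 0 ≤ B * ((1 + ‖ξ‖) ^ 2)⁻¹ := by positivity
    have h1 : ‖V ξ l‖ ≤ B * ((1 + ‖ξ‖) ^ 2)⁻¹ := (hB t).apply l ξ
    exact pow_le_pow_left₀ (norm_nonneg _) h1 2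
  rw [eLpNorm_eq_lintegral_rpow_enorm_toReal two_ne_zero ENNReal.ofNat_ne_top, ENNReal.toReal_ofNat]
  have hsq' : ∫⁻ x, ‖clayProjForce hT hf hd t x‖ₑ ^ (2 : ℝ) ≤ G₂sq := by
    refine le_trans (le_of_eq (lintegral_congr fun x => ?_)) hsq
    rw [← ENNReal.rpow_natCast]; norm_num
  exact ENNReal.rpow_le_rpow hsq' (by norm_num)

/-- **The re-gauge `(u, p, f) ↦ (u, p - p_f, P f)`**: a classical solution of the Navier–Stokes
system on `[0, T] × ℝ³` driven by the raw force `f` is a classical solution driven by the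
PROJECTED force `P f` with the pressure `p - Δ⁻¹∇·f` (the momentum equation only sees `-∇p + f`;
Tao 2013, (8)). Converse of the tree's `IsClassicalNSSolutionOn.of_lerayPart_forceData`. [cite: Tao2011, (8) p. 3] -/
theorem IsClassicalNSSolutionOn.to_clayProjForce {ν : ℝ}
    {u : ℝ → EuclideanSpace ℝ (Fin 3) → EuclideanSpace ℝ (Fin 3)}
    {p : ℝ → EuclideanSpace ℝ (Fin 3) → ℝ} (h : IsClassicalNSSolutionOn (Icc 0 T) ν f u p) :
    IsClassicalNSSolutionOn (Icc 0 T) ν (clayProjForce hT hf hd) u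
      (fun t x => p t x + (-1 : ℝ) • (𝓕 (forcePresSymbol (forceData hT hf hd t)) x).re) := by
  refine h.add_gradient ((isSmoothSpaceTimeOn_forcePressure_forceData hT hf hd).const_smul (-1))
    fun t ht x => ?_
  have hd1 : DifferentiableAt ℝ (fun y => (𝓕 (forcePresSymbol (forceData hT hf hd t)) y).re) x :=
    (((isSmoothSpaceTimeOn_forcePressure_forceData hT hf hd).contDiff_slice ht).differentiable
      (by simp)).differentiableAt
  have hneg : gradient (fun y => (-1 : ℝ) • (𝓕 (forcePresSymbol (forceData hT hf hd t)) y).re) x =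
      -gradient (fun y => (𝓕 (forcePresSymbol (forceData hT hf hd t)) y).re) x := by
    have hfun : (fun y => (-1 : ℝ) • (𝓕 (forcePresSymbol (forceData hT hf hd t)) y).re) =
        (-1 : ℝ) • fun y => (𝓕 (forcePresSymbol (forceData hT hf hd t)) y).re := rfl
    rw [gradient, gradient, hfun, fderiv_const_smul hd1 (-1 : ℝ), map_smul, neg_one_smul]
  rw [hneg, clayProjForce_eq_sub_gradient_of_mem hT hf hd ht]
  abel

end Proj

end Literature.Analysis.FluidPDE

end
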